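import Summits.ValiantsHypothesis.ValiantsHypothesis.Theorems.LacunarySymmetroidMatrixDescartesCensusThinLaw
import Summits.ValiantsHypothesis.ValiantsHypothesis.Theorems.LacunarySymmetroidMatrixDescartesCensusK1SupportBounds
import Summits.ValiantsHypothesis.ValiantsHypothesis.Theorems.LacunarySymmetroidMatrixDescartesCensusSupportNormalForm
import Summits.ValiantsHypothesis.ValiantsHypothesis.Theorems.LacunarySymmetroidMatrixDescartesCensusTNCUnif
import Summits.ValiantsHypothesis.ValiantsHypothesis.Theorems.LacunarySymmetroidMatrixDescartesCensusTNCUnifB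
import Summits.ValiantsHypothesis.ValiantsHypothesis.Theorems.LacunarySymmetroidMatrixDescartesCensusTNCUnifC
import Summits.ValiantsHypothesis.ValiantsHypothesis.Theorems.LacunarySymmetroidMatrixDescartesCensusTNCUnifD
import Summits.ValiantsHypothesis.ValiantsHypothesis.Theorems.LacunarySymmetroidMatrixDescartesCensusTNCUnifE
import Summits.ValiantsHypothesis.ValiantsHypothesis.Theorems.LacunarySymmetroidMatrixDescartesCensusTNCUnifF

/-!
# `MatrixDescartes` census — DOOR A: the K1 theorem targets `DoorA26` / `DoorA34`, their links and reductions

HONEST FRAMING.  Object-search cell `pub-symmetroid`, crux `Theses.LacunarySymmetroid.MatrixDescartes`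
(stmt-ValiantsHypothesis-18050).  `DoorA26 := PosRootLawAt 2 6 19` («`ζ_sym(2,6) ≤ 19 = D − 1`») and
`DoorA34 := PosRootLawAt 3 4 18` («`ζ_sym(3,4) ≤ 18 = D − 1`») are the cell's standalone theorem TARGETS for the K1
question (lead g5, `HOME/K1-PENCILTRANSFER-ANSWER.md` §3; coordinator directive 2026-08-23), typed in the Defs module and
NOT asserted anywhere.  This file is bookkeeping around them, all elementary:

* unfoldings (`doorA26_iff`, `doorA34_iff`, `posRootLawAt_iff_forall_on` — `Iff.rfl`) and the REDUCTION TO PRIMITIVE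
  NORMAL-FORM SUPPORTS (`doorA26_iff_primitive`, `doorA34_iff_primitive`, from `Census.posRootLawAt_iff_primitive`):
  door A holds iff the support-level row `PosRootLawOn 2 6 19 d` holds for every `0 = d₀ < d₁ < ⋯ < d₅` with
  `gcd = 1` — exactly the index set of the cell's certificate TABLE (DATA-CUT item (b));
* the K1 register reading: given the kernel lower bounds, `DoorA26 ↔ ζ_sym(2,6) ∈ {18, 19}` and `DoorA34 ↔ ζ_sym(3,4) = 18`
  (`doorA26_iff_register`, `doorA34_iff_register`); the negations are single Descartes-SHARP witnesses
  (`not_doorA26_iff`, `not_doorA34_iff`: a symmetric pencil with exactly `20`, resp. `19`, distinct positive roots);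
* the links to the cell's typed conjectures: either door refutes `FormatExtremalAll` (the all-formats hypothesis of the
  fork theorem, which then does not fire) and `DescartesExtremalThin` (STRUCTURE §2.2 thin scope) —
  `not_formatExtremalAll_of_doorA26`, `not_descartesExtremalThin_of_doorA26`, `…_of_doorA34`;
* what is PROVED toward `DoorA26` in the kernel, restated in the table's currency: the seven record supports
  (`doorA26_on_record_supports`, from `Census.ub19_on_2_6_record_supports`).

Neither door implies anything about `MatrixDescartes` (consumed by the route only at fat formats); nothing here bears on
`VP ≠ VNP`.

[folklore] Bookkeeping; no citation exists or is needed.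
-/

-- `Summit.ValiantsHypothesis.ValiantsHypothesis.…` repeats a component by the D-0017 layout
-- (single-conjunct summit), which the `dupNamespace` linter flags; the name is mandated.
set_option linter.dupNamespace false

namespace Summit.ValiantsHypothesis.ValiantsHypothesis.Theorems.LacunarySymmetroidMatrixDescartes.Census

open Polynomial Finset
open scoped BigOperators Polynomial Matrix
open Summit.ValiantsHypothesis.ValiantsHypothesis.Theorems.MatrixDescartes.Negative (PosRootLawAt)

/-! ## Unfoldings -/

/-- A format row is the conjunction of its support rows. [folklore] -/
theorem posRootLawAt_iff_forall_on (m K B : ℕ) : PosRootLawAt m K B ↔ ∀ d, PosRootLawOn m K B d := Iff.rfl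

/-- Support rows are monotone in the bound. [folklore] -/
theorem posRootLawOn_mono {m K B B' : ℕ} {d : Fin K → ℕ} (hBB' : B ≤ B') (h : PosRootLawOn m K B d) :
    PosRootLawOn m K B' d :=
  fun S hS => (h S hS).trans hBB'

/-- A format row restricts to each support. [folklore] -/
theorem posRootLawOn_of_posRootLawAt {m K B : ℕ} (h : PosRootLawAt m K B) (d : Fin K → ℕ) :
    PosRootLawOn m K B d :=
  h d

/-- **`DoorA26` unfolded**: every `6`-term real symmetric `2 × 2` pencil has at most `19` distinct positive roots of its
determinant. [folklore] -/
theorem doorA26_iff :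
    DoorA26 ↔ ∀ (d : Fin 6 → ℕ) (S : Fin 6 → Matrix (Fin 2) (Fin 2) ℝ), (∀ l, (S l).IsSymm) →
      ((∑ l, (X : ℝ[X]) ^ d l • (S l).map C).det.roots.toFinset.filter (fun t => 0 < t)).card ≤ 19 :=
  Iff.rfl

/-- **`DoorA34` unfolded**: every `4`-term real symmetric `3 × 3` pencil has at most `18` distinct positive roots of its
determinant. [folklore] -/
theorem doorA34_iff :
    DoorA34 ↔ ∀ (d : Fin 4 → ℕ) (S : Fin 4 → Matrix (Fin 3) (Fin 3) ℝ), (∀ l, (S l).IsSymm) →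
      ((∑ l, (X : ℝ[X]) ^ d l • (S l).map C).det.roots.toFinset.filter (fun t => 0 < t)).card ≤ 18 :=
  Iff.rfl

/-- `DoorA26` in the table's currency: all support rows `ζ(2,6; d) ≤ 19`. [folklore] -/
theorem doorA26_iff_forall_on : DoorA26 ↔ ∀ d : Fin 6 → ℕ, PosRootLawOn 2 6 19 d := Iff.rfl

/-- `DoorA34` in the table's currency: all support rows `ζ(3,4; d) ≤ 18`. [folklore] -/
theorem doorA34_iff_forall_on : DoorA34 ↔ ∀ d : Fin 4 → ℕ, PosRootLawOn 3 4 18 d := Iff.rfl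

/-! ## Reduction to the census's index set: primitive normal-form supports -/

/-- **Door A reduces to the certificate table's index set**: `DoorA26` holds iff `ζ(2,6; d) ≤ 19` for every support in
normal form `0 = d₀ < d₁ < ⋯ < d₅` with `gcd(d) = 1`. [folklore] -/
theorem doorA26_iff_primitive :
    DoorA26 ↔ ∀ d : Fin 6 → ℕ, StrictMono d → d 0 = 0 → Finset.univ.gcd d = 1 → PosRootLawOn 2 6 19 d :=
  posRootLawAt_iff_primitive 2 4 19

/-- The same reduction without the `gcd` normalisation (sorted supports starting at `0`). [folklore] -/
theorem doorA26_iff_strictMono :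
    DoorA26 ↔ ∀ d : Fin 6 → ℕ, StrictMono d → d 0 = 0 → PosRootLawOn 2 6 19 d :=
  posRootLawAt_iff_strictMono 2 5 19

/-- **`DoorA34` reduces to primitive normal-form supports** `0 = d₀ < d₁ < d₂ < d₃`, `gcd(d) = 1`. [folklore] -/
theorem doorA34_iff_primitive :
    DoorA34 ↔ ∀ d : Fin 4 → ℕ, StrictMono d → d 0 = 0 → Finset.univ.gcd d = 1 → PosRootLawOn 3 4 18 d :=
  posRootLawAt_iff_primitive 3 2 18

/-- The same reduction without the `gcd` normalisation. [folklore] -/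
theorem doorA34_iff_strictMono :
    DoorA34 ↔ ∀ d : Fin 4 → ℕ, StrictMono d → d 0 = 0 → PosRootLawOn 3 4 18 d :=
  posRootLawAt_iff_strictMono 3 3 18

/-! ## The K1 register reading and the shape of a counterexample -/

/-- The Descartes row at `(2,6)` (`ζ ≤ 20 = D`) and the kernel lower bound (`ζ ≥ 18`) — `Census.bounds_2_6'`; hence
**`DoorA26 ↔ ζ_sym(2,6) ∈ {18, 19}`** in row form. [folklore] -/
theorem doorA26_iff_register : DoorA26 ↔ (¬ PosRootLawAt 2 6 17 ∧ PosRootLawAt 2 6 19) :=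
  ⟨fun h => ⟨bounds_2_6'.1, h⟩, fun h => h.2⟩

/-- **`DoorA34 ↔ ζ_sym(3,4) = 18`** in row form (kernel lower bound `Census.bounds_3_4'`). [folklore] -/
theorem doorA34_iff_register : DoorA34 ↔ (¬ PosRootLawAt 3 4 17 ∧ PosRootLawAt 3 4 18) :=
  ⟨fun h => ⟨bounds_3_4'.1, h⟩, fun h => h.2⟩

/-- **Door A fails iff some symmetric pencil is Descartes-SHARP at `(2,6)`**: exactly `20 = C(7,2) − 1` distinct positive
roots (more is impossible by Descartes, `Census.bounds_2_6'`). [folklore] -/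
theorem not_doorA26_iff :
    ¬ DoorA26 ↔ ∃ (d : Fin 6 → ℕ) (S : Fin 6 → Matrix (Fin 2) (Fin 2) ℝ), (∀ l, (S l).IsSymm) ∧
      ((∑ l, (X : ℝ[X]) ^ d l • (S l).map C).det.roots.toFinset.filter (fun t => 0 < t)).card = 20 := by
  constructor
  · intro h
    simp only [DoorA26, PosRootLawAt, not_forall, not_le] at h
    obtain ⟨d, S, hS, hlt⟩ := h
    exact ⟨d, S, hS, le_antisymm (bounds_2_6'.2 d S hS) hlt⟩
  · rintro ⟨d, S, hS, h20⟩ h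
    have := h d S hS
    omega

/-- **`DoorA34` fails iff some SYMMETRIC pencil is Descartes-sharp at `(3,4)`**: exactly `19 = C(6,3) − 1` distinct
positive roots (general pencils do reach `19`, `Census.G3K4E1.card_posRoots_eq`; symmetric ones of record reach `18`). [folklore] -/
theorem not_doorA34_iff :
    ¬ DoorA34 ↔ ∃ (d : Fin 4 → ℕ) (S : Fin 4 → Matrix (Fin 3) (Fin 3) ℝ), (∀ l, (S l).IsSymm) ∧
      ((∑ l, (X : ℝ[X]) ^ d l • (S l).map C).det.roots.toFinset.filter (fun t => 0 < t)).card = 19 := by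
  constructor
  · intro h
    simp only [DoorA34, PosRootLawAt, not_forall, not_le] at h
    obtain ⟨d, S, hS, hlt⟩ := h
    exact ⟨d, S, hS, le_antisymm (bounds_3_4'.2 d S hS) hlt⟩
  · rintro ⟨d, S, hS, h19⟩ h
    have := h d S hS
    omega

/-! ## Links to the cell's typed conjectures -/

/-- **Door A refutes the all-formats law** `FormatExtremalAll` (the hypothesis of the fork theorem
`Census.not_matrixDescartes_of_formatExtremalAll`, which therefore does not fire under door A): at `(2,6)` that law demands a
pencil with `20` positive roots. [folklore] -/
theorem not_formatExtremalAll_of_doorA26 (h : DoorA26) : ¬ FormatExtremalAll := by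
  intro hA
  have h' := (hA 2 6 (by norm_num) (by norm_num)).2
  have e : Nat.choose (2 + 6 - 1) 2 - 2 = 19 := by decide
  rw [e] at h'
  exact h' h

/-- **Door A refutes the thin law** `DescartesExtremalThin` (its open part (b) at `K = 6` asks for `ζ_sym(2,6) = 20`). [folklore] -/
theorem not_descartesExtremalThin_of_doorA26 (h : DoorA26) : ¬ DescartesExtremalThin := by
  intro hT
  have h' := (descartesExtremalThin_iff_open.1 hT).2.1 6 le_rfl
  have e : Nat.choose (6 + 1) 2 - 2 = 19 := by decide
  rw [e] at h'
  exact h' h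

/-- `DoorA34` refutes the all-formats law (at `(3,4)` it demands a symmetric pencil with `19` positive roots). [folklore] -/
theorem not_formatExtremalAll_of_doorA34 (h : DoorA34) : ¬ FormatExtremalAll := by
  intro hA
  have h' := (hA 3 4 (by norm_num) (by norm_num)).2
  have e : Nat.choose (3 + 4 - 1) 3 - 2 = 18 := by decide
  rw [e] at h'
  exact h' h

/-- `DoorA34` refutes the thin law (its open part (c) at `K = 4` asks for `ζ_sym(3,4) = 19`). [folklore] -/
theorem not_descartesExtremalThin_of_doorA34 (h : DoorA34) : ¬ DescartesExtremalThin := by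
  intro hT
  have h' := (descartesExtremalThin_iff_open.1 hT).2.2 4 le_rfl
  have e : Nat.choose (4 + 2) 3 - 2 = 18 := by decide
  rw [e] at h'
  exact h' h

/-- Conversely the all-formats law denies both doors (contrapositive bookkeeping). [folklore] -/
theorem not_doorA26_of_formatExtremalAll (h : FormatExtremalAll) : ¬ DoorA26 :=
  fun hD => not_formatExtremalAll_of_doorA26 hD h

/-! ## What is proved toward `DoorA26`: the record supports, in the table's currency -/

/-- **Kernel rows of the door-A table on the record family** `(0,9,11,12,17,N)`: `ζ(2,6; d) ≤ 19` for
`N ∈ {35, 180, 200, 201, 176, 178, 179}` (T-NC certificates, `Census.ub19_on_2_6_record_supports`). [folklore] -/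
theorem doorA26_on_record_supports :
    PosRootLawOn 2 6 19 ![0, 9, 11, 12, 17, 35] ∧ PosRootLawOn 2 6 19 ![0, 9, 11, 12, 17, 180] ∧
    PosRootLawOn 2 6 19 ![0, 9, 11, 12, 17, 200] ∧ PosRootLawOn 2 6 19 ![0, 9, 11, 12, 17, 201] ∧
    PosRootLawOn 2 6 19 ![0, 9, 11, 12, 17, 176] ∧ PosRootLawOn 2 6 19 ![0, 9, 11, 12, 17, 178] ∧
    PosRootLawOn 2 6 19 ![0, 9, 11, 12, 17, 179] :=
  ub19_on_2_6_record_supports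

/-! ## Appended (typer gen 5): door-A table rows for WHOLE ONE-PARAMETER FAMILIES (uniform T-NC certificates) -/

/-- **The record family, uniformly**: `ζ(2,6; 0,9,11,12,17,N) ≤ 19` for EVERY `N ≥ 35` — the supports carrying the census
record `(2,6) = 18` (uniform T-NC certificate `Census.posRoots_le_19_on_2_6_0_9_11_12_17_N`). [folklore] -/
theorem doorA26_on_record_family (N : ℕ) (hN : 35 ≤ N) :
    PosRootLawOn 2 6 19 (![0, 9, 11, 12, 17, N] : Fin 6 → ℕ) :=
  fun S hS => posRoots_le_19_on_2_6_0_9_11_12_17_N N hN S hS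

/-- The family `(0,1,4,10,12,N)`, uniformly: `ζ(2,6; d) ≤ 19` for every `N ≥ 25`. [folklore] -/
theorem doorA26_on_family_0_1_4_10_12 (N : ℕ) (hN : 25 ≤ N) :
    PosRootLawOn 2 6 19 (![0, 1, 4, 10, 12, N] : Fin 6 → ℕ) :=
  fun S hS => posRoots_le_19_on_2_6_0_1_4_10_12_N N hN S hS

/-- The family `(0,3,4,11,16,N)` (the cell's «KILL13» base), uniformly: `ζ(2,6; d) ≤ 19` for every `N ≥ 33`. [folklore] -/
theorem doorA26_on_family_0_3_4_11_16 (N : ℕ) (hN : 33 ≤ N) :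
    PosRootLawOn 2 6 19 (![0, 3, 4, 11, 16, N] : Fin 6 → ℕ) :=
  fun S hS => posRoots_le_19_on_2_6_0_3_4_11_16_N N hN S hS

/-- The family `(0,8,9,11,15,N)` — the census's third 18-carrying base — uniformly: `ζ(2,6; d) ≤ 19` for every `N ≥ 31`. [folklore] -/
theorem doorA26_on_family_0_8_9_11_15 (N : ℕ) (hN : 31 ≤ N) :
    PosRootLawOn 2 6 19 (![0, 8, 9, 11, 15, N] : Fin 6 → ℕ) :=
  fun S hS => posRoots_le_19_on_2_6_0_8_9_11_15_N N hN S hS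

/-- The family `(0,9,10,12,16,N)` (18-carrying at `N = 65`), uniformly for `N ≥ 33`. [folklore] -/
theorem doorA26_on_family_0_9_10_12_16 (N : ℕ) (hN : 33 ≤ N) :
    PosRootLawOn 2 6 19 (![0, 9, 10, 12, 16, N] : Fin 6 → ℕ) :=
  fun S hS => posRoots_le_19_on_2_6_0_9_10_12_16_N N hN S hS

/-- The family `(0,4,6,7,15,N)` (18-carrying at `N = 331`), uniformly for `N ≥ 31`. [folklore] -/
theorem doorA26_on_family_0_4_6_7_15 (N : ℕ) (hN : 31 ≤ N) :
    PosRootLawOn 2 6 19 (![0, 4, 6, 7, 15, N] : Fin 6 → ℕ) :=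
  fun S hS => posRoots_le_19_on_2_6_0_4_6_7_15_N N hN S hS

end Summit.ValiantsHypothesis.ValiantsHypothesis.Theorems.LacunarySymmetroidMatrixDescartes.Census
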